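import Summits.QuantumFields.BalabanUV.T4Continuum.Support.NE7K1LinStripClassCauchy

/-!
# NE7K1LinStripClassNN — row NE7 (node U5), candidate route HOM, path H1L, cell K1-lin(s): NEEDS-ESTIMATE #E1, R-E1 TRANCHE B —
# THE CLASS `S` IS CONVEX, AND b04's BLOCK LAPLACIAN `Δ^ξ_n + m²` IS A MEMBER (so the re-typed strip engine CONTAINS b04's, and every
# segment `(1−s)σ₀ + sσ₁` of members is a member with `s`-FREE constants)

Lineage `b2b-balaban-t4-ne7-p2` (CRUX PROVER NE7 #2), generation 76; file 64.  Files 62–63 typed the class `SymbS n σ r C_S C_up` and the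
uniform zero-free strip of the regrouped denominator `ES n σ a` over it.  THIS FILE ([folklore]):

* §1 **`symbS_segment`** — CONVEXITY: `σ₀ ∈ S(n; r, C₀, U₀)`, `σ₁ ∈ S(n; r, C₁, U₁)`, `0 ≤ s ≤ 1` ⇒
  `(1−s)σ₀ + sσ₁ ∈ S(n; r, max C₀ C₁, max U₀ U₁)` — every clause of the class is affine or convex in `σ`; the constants of the
  segment do NOT depend on `s` (lens 2's S-58-2: «the class … CONVEX ∋ NN, so σ_s ∈ S for every s with s-free constants»);
  `symbS_of_le` (monotonicity in `(C_S, C_up)` under admissibility), `symbS_of_radius_le` (shrinking `r`).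
* §2 **`symbS_DeltaXi`** — b04's symbol `Δ^ξ_n + m²` (`m² ≥ 0`) is in `S(n; r, 25∕16, 16d + m²)` for every admissible radius
  `0 < r ≤ 1∕4`, `25·d·r² ≤ 1`, every `n ≥ 1`: (S1) `Sxi_add_nat_mul`, (S2) `differentiableAt_DeltaXi`, (S3) `DeltaXi_ofReal`,
  (S4) b04's `re_Sxi_ge` summed (the floor with `C_S = 25∕16`, the shape the class was modelled on), (S5) `norm_DeltaXi_le` — all BY NAME.
* §3 **`uniformStrip_DeltaXi`** — b04's `uniformStrip_explicit` RECOVERED through the class (sanity of the re-typing: the class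
  engine specialises to the typed one, with the class constants `κ_S(d, a₋, a₊, 16d + m²₊, r_NN(d))`, `c_S = a₋(4∕π²)^d∕2`).

HONEST FRAMING: [folklore] bookkeeping; the NN membership is b04's own lemmas regrouped; nothing of Bałaban's asserted; no `sorry`.  Census
only; NE7 NOT PRINTED ∕ NOT PROVED; spine 0∕9; FIXED FINITE T⁴, rung (B)+1; NOT infinite volume, NOT mass gap, NOT Clay.  HONEST DEPENDENCY:
continuum YM on T⁴ ⇐ BetaPertH ∧ nine spine estimates (0/9 proved); BetaPertH ⇐ (D1) ∧ (D4) ∧ CAP+tail; G-an2-4 gates asym, D1 and NE2/3/4.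
-/

noncomputable section

open Finset Complex Set

namespace Summit.QuantumFields.BalabanUV.T4Continuum.NE7K1LinStripClassNN

open Literature.MathematicalPhysics.QuantumFieldTheory.Balaban1983to89
open Literature.MathematicalPhysics.QuantumFieldTheory.Balaban1983to89.B4Strip
open Literature.MathematicalPhysics.QuantumFieldTheory.Balaban1983to89.B4StripCauchy
open Literature.MathematicalPhysics.QuantumFieldTheory.Balaban1983to89.B4StripSums
open Literature.MathematicalPhysics.QuantumFieldTheory.Balaban1983to89.B5Strip145Analytic
open NE7K1LinStripClass NE7K1LinStripClassCauchy

variable {d : ℕ}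

/-! ### §1 Convexity and monotonicity of the class -/

/-- **THE CLASS IS CONVEX**: a segment of two members (same mesh, same radius) is a member, with the `max` of the constants —
INDEPENDENT of the interpolation parameter `s ∈ [0,1]`. [folklore] -/
theorem symbS_segment {n : ℕ} {σ₀ σ₁ : (Fin d → ℂ) → ℂ} {r C₀ C₁ U₀ U₁ : ℝ} (h0 : SymbS n σ₀ r C₀ U₀) (h1 : SymbS n σ₁ r C₁ U₁)
    {s : ℝ} (hs0 : 0 ≤ s) (hs1 : s ≤ 1) :
    SymbS n (fun q => (1 - s) * σ₀ q + s * σ₁ q) r (max C₀ C₁) (max U₀ U₁) where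
  r_pos := h0.r_pos
  r_le := h0.r_le
  cs_nonneg := le_max_of_le_left h0.cs_nonneg
  small := by
    have hdr : 0 ≤ (d : ℝ) * r ^ 2 := by positivity
    rcases le_total C₀ C₁ with hc | hc
    · rw [max_eq_right hc]; exact h1.small
    · rw [max_eq_left hc]; exact h0.small
  periodic := fun q μ => by simp only [h0.periodic q μ, h1.periodic q μ]
  holo := fun q hq => ((h0.holo q hq).const_mul _).add ((h1.holo q hq).const_mul _)
  real := fun x => by
    have e0 := h0.real x
    have e1 := h1.real x
    simp only [Complex.add_im, Complex.mul_im, Complex.sub_re, Complex.one_re, Complex.ofReal_re, Complex.sub_im,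
      Complex.one_im, Complex.ofReal_im, sub_zero, e0, e1, mul_zero, zero_mul, add_zero]
  floor := fun x η hη => by
    have f0 := h0.floor x η hη
    have f1 := h1.floor x η hη
    have hsum : 0 ≤ ∑ ν, η ν ^ 2 := Finset.sum_nonneg (fun ν _ => sq_nonneg _)
    have hm0 : C₀ * ∑ ν, η ν ^ 2 ≤ max C₀ C₁ * ∑ ν, η ν ^ 2 := mul_le_mul_of_nonneg_right (le_max_left _ _) hsum
    have hm1 : C₁ * ∑ ν, η ν ^ 2 ≤ max C₀ C₁ * ∑ ν, η ν ^ 2 := mul_le_mul_of_nonneg_right (le_max_right _ _) hsum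
    have e : ((1 - (s : ℂ)) * σ₀ (cpt x η) + (s : ℂ) * σ₁ (cpt x η)).re
        = (1 - s) * (σ₀ (cpt x η)).re + s * (σ₁ (cpt x η)).re := by
      simp only [Complex.add_re, Complex.mul_re, Complex.sub_re, Complex.one_re, Complex.ofReal_re, Complex.sub_im,
        Complex.one_im, Complex.ofReal_im, sub_zero, zero_mul, sub_zero]
    rw [e]
    have hs1' : 0 ≤ 1 - s := by linarith
    nlinarith [mul_le_mul_of_nonneg_left f0 hs1', mul_le_mul_of_nonneg_left f1 hs0]
  upper := fun q hq => by
    have u0 := h0.upper q hq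
    have u1 := h1.upper q hq
    have hs1' : 0 ≤ 1 - s := by linarith
    calc ‖(1 - (s : ℂ)) * σ₀ q + (s : ℂ) * σ₁ q‖ ≤ ‖(1 - (s : ℂ)) * σ₀ q‖ + ‖(s : ℂ) * σ₁ q‖ := norm_add_le _ _
      _ = (1 - s) * ‖σ₀ q‖ + s * ‖σ₁ q‖ := by
          rw [norm_mul, norm_mul, show (1 - (s : ℂ)) = ((1 - s : ℝ) : ℂ) by push_cast; ring, Complex.norm_real,
            Complex.norm_real, Real.norm_eq_abs, Real.norm_eq_abs, abs_of_nonneg hs1', abs_of_nonneg hs0]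
      _ ≤ (1 - s) * max U₀ U₁ + s * max U₀ U₁ := by
          gcongr
          · exact u0.trans (le_max_left _ _)
          · exact u1.trans (le_max_right _ _)
      _ = max U₀ U₁ := by ring

/-- monotonicity: larger constants `(C_S, C_up)` are admissible as long as `16·C_S·d·r² ≤ 1` persists. [folklore] -/
theorem symbS_of_le {n : ℕ} {σ : (Fin d → ℂ) → ℂ} {r C C' U U' : ℝ} (h : SymbS n σ r C U) (hC : C ≤ C') (hU : U ≤ U')
    (hsmall : 16 * C' * ((d : ℝ) * r ^ 2) ≤ 1) : SymbS n σ r C' U' where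
  r_pos := h.r_pos
  r_le := h.r_le
  cs_nonneg := h.cs_nonneg.trans hC
  small := hsmall
  periodic := h.periodic
  holo := h.holo
  real := h.real
  floor := fun x η hη => by
    have f := h.floor x η hη
    have hsum : 0 ≤ ∑ ν, η ν ^ 2 := Finset.sum_nonneg (fun ν _ => sq_nonneg _)
    nlinarith [mul_le_mul_of_nonneg_right hC hsum]
  upper := fun q hq => (h.upper q hq).trans hU

/-- shrinking the radius keeps membership (the tube, the fat region and the admissibility only shrink). [folklore] -/
theorem symbS_of_radius_le {n : ℕ} {σ : (Fin d → ℂ) → ℂ} {r r' C U : ℝ} (h : SymbS n σ r C U) (hr0 : 0 < r') (hr : r' ≤ r) :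
    SymbS n σ r' C U where
  r_pos := hr0
  r_le := hr.trans h.r_le
  cs_nonneg := h.cs_nonneg
  small := by
    have h1 : (d : ℝ) * r' ^ 2 ≤ d * r ^ 2 :=
      mul_le_mul_of_nonneg_left (pow_le_pow_left₀ hr0.le hr 2) (Nat.cast_nonneg d)
    nlinarith [h.small, h.cs_nonneg, mul_le_mul_of_nonneg_left h1 (mul_nonneg (by norm_num : (0:ℝ) ≤ 16) h.cs_nonneg)]
  periodic := h.periodic
  holo := fun q hq => h.holo q (fun ν => (hq ν).trans (by linarith))
  real := h.real
  floor := fun x η hη => h.floor x η (fun ν => (hη ν).trans (by linarith))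
  upper := fun q hq => h.upper q (fun ν => ⟨(hq ν).1.trans (by linarith), (hq ν).2.trans (by linarith)⟩)

/-! ### §2 b04's block Laplacian is a member -/

/-- `S_ξ` is `2πn`-periodic. [folklore] -/
theorem Sxi_add_two_pi_n (n : ℕ) (hn : n ≠ 0) (z : ℂ) : Sxi n (z + 2 * Real.pi * n) = Sxi n z := by
  have := Sxi_add_nat_mul n hn z 0 1
  simpa using this

/-- `Δ^ξ_n + m²` is `2πn`-periodic in every coordinate. [folklore] -/
theorem DeltaXi_periodic (n : ℕ) (hn : n ≠ 0) (m2 : ℝ) (q : Fin d → ℂ) (μ : Fin d) :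
    DeltaXi n m2 (Function.update q μ (q μ + 2 * Real.pi * n)) = DeltaXi n m2 q := by
  unfold DeltaXi
  congr 1
  refine Finset.sum_congr rfl (fun ν _ => ?_)
  by_cases hν : ν = μ
  · subst hν; rw [Function.update_self, Sxi_add_two_pi_n n hn]
  · rw [Function.update_of_ne hν]

/-- the real part of `Δ^ξ_n + m²` at `x + iη`: `≥ Δ^ξ_n(x) − (25∕16)Σ_ν η_ν² + m²` for `|η_ν| ≤ 1` (b04's `re_Sxi_ge` summed). [folklore] -/
theorem re_DeltaXi_cpt_ge (n : ℕ) (hn : 1 ≤ n) (m2 : ℝ) (x η : Fin d → ℝ) (hη : ∀ ν, |η ν| ≤ 1) :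
    DeltaXir n 0 x - 25 / 16 * ∑ ν, η ν ^ 2 + m2 ≤ (DeltaXi n m2 (cpt x η)).re := by
  have hre : (DeltaXi n m2 (cpt x η)).re = ∑ ν, (Sxi n (cpt x η ν)).re + m2 := by
    simp [DeltaXi, Complex.re_sum]
  rw [hre]
  have hx : DeltaXir n 0 x = ∑ ν, 4 * (n : ℝ) ^ 2 * Real.sin (x ν / (2 * n)) ^ 2 := by
    unfold DeltaXir; rw [add_zero]; exact Finset.sum_congr rfl (fun ν _ => Sxir_eq n _)
  rw [hx, Finset.mul_sum, ← Finset.sum_sub_distrib]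
  have hν : ∀ ν, 4 * (n : ℝ) ^ 2 * Real.sin (x ν / (2 * n)) ^ 2 - 25 / 16 * η ν ^ 2 ≤ (Sxi n (cpt x η ν)).re := by
    intro ν
    have h := re_Sxi_ge n hn (cpt x η ν) (by simp [cpt]; exact hη ν)
    have e1 : (cpt x η ν).re = x ν := by simp [cpt]
    have e2 : (cpt x η ν).im = η ν := by simp [cpt]
    rw [e1, e2] at h
    exact h
  linarith [Finset.sum_le_sum (fun ν (_ : ν ∈ Finset.univ) => hν ν)]

/-- **b04's BLOCK LAPLACIAN IS IN THE CLASS**: `Δ^ξ_n + m² ∈ S(n; r, 25∕16, 16d + m²)` for every `n ≥ 1`, `m² ≥ 0` and every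
admissible radius `0 < r ≤ 1∕4`, `25·d·r² ≤ 1`. [folklore] -/
theorem symbS_DeltaXi (n : ℕ) [NeZero n] (m2 : ℝ) (hm : 0 ≤ m2) {r : ℝ} (hr0 : 0 < r) (hr : r ≤ 1 / 4)
    (hdr : 25 * ((d : ℝ) * r ^ 2) ≤ 1) : SymbS n (DeltaXi (d := d) n m2) r (25 / 16) (16 * d + m2) where
  r_pos := hr0
  r_le := hr
  cs_nonneg := by norm_num
  small := by linarith
  periodic := fun q μ => DeltaXi_periodic n (NeZero.ne n) m2 q μ
  holo := fun q _ => differentiableAt_DeltaXi n m2 q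
  real := fun s => by rw [DeltaXi_ofReal]; exact Complex.ofReal_im _
  floor := fun x η hη => by
    have hn : 1 ≤ n := Nat.one_le_iff_ne_zero.mpr (NeZero.ne n)
    have h1 : ∀ ν, |η ν| ≤ 1 := fun ν => (hη ν).trans (by linarith)
    have := re_DeltaXi_cpt_ge n hn m2 x η h1
    linarith
  upper := fun q hq => norm_DeltaXi_le n (Nat.one_le_iff_ne_zero.mpr (NeZero.ne n)) m2 hm hr hq

/-! ### §3 b04's uniform strip recovered through the class -/

/-- the NN radius `r_NN = 1∕(5(d+1))` (`≤ 1∕4`, `25·d·r² ≤ 1`). [folklore] -/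
def rNN (d : ℕ) : ℝ := 1 / (5 * ((d : ℝ) + 1))

/-- `r_NN > 0`. [folklore] -/
theorem rNN_pos (d : ℕ) : 0 < rNN d := by unfold rNN; positivity

/-- `r_NN ≤ 1∕4`. [folklore] -/
theorem rNN_le (d : ℕ) : rNN d ≤ 1 / 4 := by
  unfold rNN
  have : (0:ℝ) ≤ d := Nat.cast_nonneg d
  rw [div_le_div_iff₀ (by positivity) (by norm_num)]
  linarith

/-- `25·d·r_NN² ≤ 1`. [folklore] -/
theorem rNN_small (d : ℕ) : 25 * ((d : ℝ) * rNN d ^ 2) ≤ 1 := by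
  unfold rNN
  have hd : (0:ℝ) ≤ d := Nat.cast_nonneg d
  rw [div_pow, one_pow, mul_one_div, ← mul_div_assoc, div_le_iff₀ (by positivity)]
  nlinarith

/-- **b04's UNIFORM STRIP RECOVERED THROUGH THE CLASS** (sanity of the re-typing): for `0 < a₋ ≤ a ≤ a₊`, `0 ≤ m² ≤ m²₊`, every `n ≥ 1`:
`c_S(d, a₋) ≤ ‖E n a m² p‖` on `Strip d κ_S(d, a₋, a₊, 16d + m²₊, r_NN(d))` — b04's `uniformStrip_explicit` with the class constants. [folklore] -/
theorem uniformStrip_DeltaXi (n : ℕ) [NeZero n] {aminus aplus a m2 m2plus : ℝ} (ha : 0 < aminus) (ha1 : aminus ≤ a)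
    (ha2 : a ≤ aplus) (hm : 0 ≤ m2) (hmp : m2 ≤ m2plus) :
    ∀ p ∈ Strip d (kappaS d aminus aplus (16 * d + m2plus) (rNN d)), cS d aminus ≤ ‖E n a m2 p‖ := by
  have hS : SymbS n (DeltaXi (d := d) n m2) (rNN d) (25 / 16) (16 * d + m2plus) :=
    symbS_of_le (symbS_DeltaXi n m2 hm (rNN_pos d) (rNN_le d) (rNN_small d)) le_rfl (by linarith)
      (by linarith [rNN_small d])
  intro p hp
  rw [E_eq_ES]
  exact uniformStrip hS ha ha1 ha2 p hp

end Summit.QuantumFields.BalabanUV.T4Continuum.NE7K1LinStripClassNN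

end
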